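import Mathlib.Analysis.Calculus.LocalExtr.Basic
import Mathlib.Analysis.Calculus.FDeriv.Mul
import Mathlib.Analysis.InnerProductSpace.Calculus
import Mathlib.Analysis.SpecialFunctions.Pow.Real
import Literature.Analysis.FluidPDE.VectorCalculus
import HarnessLib

/-!
# Stationary self-similar blow-up profiles for 3D incompressible Euler
# (Constantin–Ignatova–Vicol 2026, §3)

Analysis/FluidPDE definition file (request `defn-IsSelfSimilarEulerProfile` of route
`NavierStokesRegularity/VortexLineClock`, items `EmptyEulerWindow`, `TypeIIWindowCore`,
`SeifertResidual`, `FluxCapacityRecurrence`, cards `euler-window-viscous-transfer`,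
`kelvin-quantized-similarity-exponent`, which so far inline these clauses).

P. Constantin, M. Ignatova, V. Vicol, *On putative self-similarity for incompressible 3D Euler*
(arXiv:2602.17570, 2026), §3, study a hypothetical **globally self-similar singularity** of the
incompressible 3D Euler equations `∂ₜu + u·∇u + ∇p = 0`, `∇·u = 0` on the whole space: the ansatz
(3.2) `u(x,t) = (1−t)^{γ−1} U(y)`, `p(x,t) = (1−t)^{2(γ−1)} P(y)`, `ω(x,t) = (1−t)^{−1} Ω(y)`,
`y = x/(1−t)^γ`, with **similarity exponent** `γ > 0`. The profiles satisfy the **stationary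
self-similar Euler equation** (§3.1.1)

* velocity form (3.3): `(1−γ) U + γ (y·∇) U + (U·∇) U + ∇P = 0`, `∇·U = 0`;
* equivalently, vorticity form (3.4): `Ω + γ (y·∇) Ω + (U·∇) Ω = (Ω·∇) U`, `Ω = ∇ × U`,
  `∇·U = 0`;

the paper then works under the far-field bounds (3.8)
`|U(y)| ≤ C♭ |y| ⟨y⟩^{−1/γ}`, `|Ω(y)| + |∇U(y)| ≤ C♭ ⟨y⟩^{−1/γ}` (`⟨y⟩ = (1 + |y|²)^{1/2}`; the far
field respects the kernels of `(1−γ) + γ y·∇` and `1 + γ y·∇`, §3.1.3), in terms of the **total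
transport velocity** (3.19) `V(y) = γ y + U(y)` — whose integral curves are the self-similar
Lagrangian trajectories (3.20) and whose zeros (the **nodal set** `𝒩_V`, Definition 3.7) are the
stagnation points —, the **local outgoing property** (Definition 3.7, (3.37)), Elgindi's **global
outgoing property** (3.36), and the **self-similar Bernoulli function** (3.30)
`ℋ = ½|V|² + P + ½γ(γ−1)|y|²`, which obeys the transport identity (3.31) `V·∇ℋ = (2γ−1)|V|²`.

## Contents

* `selfSimilarTransport γ c U y = γ • (y − c) + U y` — `V` (3.19), centred at `c`;
  `selfSimilarNodalSet γ c U = {V = 0}` (`𝒩_V`); `IsLocallyOutgoing γ c U κ ε`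
  (Definition 3.7, constants `c_* = κ ≥ 0`, `ε_* = ε > 0`); `IsGloballyOutgoing γ c U κ` ((3.36),
  `c_* = κ > 0`) and `IsGloballyOutgoing.isLocallyOutgoing` (CIV, remark after Definition 3.7).
* `IsSelfSimilarEulerProfile γ c U P` — **the velocity form (3.3)**: `U ∈ C²`, `P ∈ C¹`,
  `(1−γ) U(y) + DU(y)[γ(y−c) + U(y)] + ∇P(y) = 0` for all `y`, `div U = 0`; API: the printed
  split form `profile_eq'`, the trivial profile `.zero`, translation `.comp_add_right`,
  change of centre `.recenter` (a constant velocity shift plus a linear pressure), and the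
  Bernoulli transport identity (3.31) `.fderiv_selfSimilarBernoulli_transport`.
* `selfSimilarBernoulli γ c U P` — `ℋ` (3.30), centred at `c`.
* on `ℝ³`: `HasSelfSimilarFarFieldWith γ c C U` — **the far-field bounds (3.8)** with constant
  `C♭ = C` (they force `U(c) = 0`, `.apply_center`), `HasSelfSimilarFarField γ c U` (`∃ C`);
  `IsSelfSimilarEulerVorticityProfile γ c U` — **the vorticity form (3.4)** with `Ω := curl U`;
  and **Proposition 3.3** (unit stretching at the vorticity maximum), proved:
  `inner_eq_norm_sq_of_isMaxOn_norm` (any field `Ω` with `Ω + DΩ[v] = w` at a global maximum of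
  `|Ω|` has `⟪Ω, w⟫ = |Ω|²`) and `IsSelfSimilarEulerVorticityProfile.inner_fderiv_curl_eq_norm_sq`
  (`⟪Ω, DU Ω⟫ = |Ω|²`, i.e. the stretching factor `α(y_*) = ξ·∇U ξ = 1`, at `y_* = argmax |Ω|`).

## Mathlib / tree search

Mathlib has no Euler profile notions. Tree (`lean search 'SelfSimilar|Profile|curl'` in
`Literature/Analysis/FluidPDE`): `IsLerayProfile ν a U P` (`SelfSimilar.lean`, Leray's *viscous*
profile system `−νΔU + aU + a(y·∇)U + (U·∇)U + ∇P = 0` — rate fixed to the parabolic `γ = ½`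
scaling `aU + a(y·∇)U`; the Euler profile has the free exponent `(1−γ)U + γ(y·∇)U` and no
Laplacian, so it is not an instance and is defined here in the same style), `curl`, `convect`,
`VectorCalculus.IsDivFree` (`VectorCalculus.lean`, reused), Elgindi's `C^{1,α}` axisymmetric
self-similar equations (`ElgindiSelfSimilarEquations.lean`, a different (polar, no-swirl) system),
Chae's asymptotically self-similar Navier–Stokes profiles (`ChaeAsymptoticallySelfSimilar*.lean`).
Nothing for the transport field / outgoing property / CIV.

## Design notes

* CIV put the singularity at `x_* = 0`, normalise `U(0) = 0` by Galilean symmetry ((3.5)) and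
  `‖∇Ω‖_∞ = 1` (resp. `‖∇²U‖_∞ = 1` in v3) by the scaling (3.6)–(3.7). The requesting route keeps a
  free centre `c ∈ ℝ³` and its own normalisation, so every notion here carries the centre `c`
  (`y ↦ y − c` in the transport field) and `IsSelfSimilarEulerProfile` is exactly the PDE (3.3)
  with the regularity `U ∈ C²`, `P ∈ C¹` (CIV, Thms 3.8–3.10: "`C²` smooth globally self-similar
  velocity profile"; the tree's `IsLerayProfile` makes the same choice), imposing neither (3.5),
  (3.7) nor the decay (3.8) — the latter is the separate predicate `HasSelfSimilarFarFieldWith`.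
  Without (3.5) the centre is a gauge (`recenter`); with (3.8) it is pinned (`apply_center`).
* The transport term is written `fderiv ℝ U y (γ • (y − c) + U y) = ((γ(y−c) + U)·∇)U(y)`,
  literally the clause the route items inline (`selfSimilarTransport_apply` is `rfl`);
  `profile_eq'` is the printed split `γ DU(y)[y−c] + (U·∇)U`.
* Japanese brackets are real powers `⟨z⟩^{−1/γ} = (1 + ‖z‖²)^{−1/(2γ)}` (the tree's idiom);
  `|∇U|` is the operator norm of `fderiv ℝ U y` (CIV do not fix a matrix norm; constants absorb).
* `IsSelfSimilarEulerProfile`, the transport field, the outgoing properties and `ℋ` are stated on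
  a finite-dimensional real inner product space `E` (free generality, as for `IsLerayProfile`);
  the far field and the vorticity form use `curl` and live on `ℝ³ = EuclideanSpace ℝ (Fin 3)`.
* NOT here (no named facts are introduced): the derivation (3.3) ⇒ (3.4) (curl of the profile
  equation) and its converse (pressure reconstruction), CIV Thm 2.1 (`γ ≥ 2/5` under finite
  energy), Thm 3.4, Thms 3.8/3.10 (outgoing ⇒ `γ ≥ ½`), §4 (axisymmetric case).

## References

* P. Constantin, M. Ignatova, V. Vicol, *On putative self-similarity for incompressible 3D Euler*,
  arXiv:2602.17570 (2026), §3.1 eqs. (3.2)–(3.8), §3.3 Prop. 3.3, §3.4 (3.19), §3.4.3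
  (3.29)–(3.33), §3.5 Def. 3.7, (3.36) [ConstantinIgnatovaVicol2026Putative]. Equation numbers as
  in arXiv v3 (= v1 for (3.2)–(3.5), (3.8), (3.19)).
* T. M. Elgindi, the global outgoing property (CIV ref. [Elgindi25]), as quoted in CIV (3.36).
-/

noncomputable section

open Set InnerProductSpace
open scoped RealInnerProductSpace

namespace Literature.Analysis.FluidPDE

/-! ### The self-similar transport field, its nodal set, and the outgoing property -/

section Transport

variable {E : Type*} [NormedAddCommGroup E] [InnerProductSpace ℝ E]

/-- The **total transport velocity** of a self-similar profile `U` with exponent `γ` and centre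
`c`: `V(y) = γ (y − c) + U(y)` (Constantin–Ignatova–Vicol, (3.19), with `y` replaced by `y − c`).
Its integral curves `dY/dτ = V(Y)` are the self-similar Lagrangian trajectories (3.20); both
profile equations (3.3), (3.4) transport along `V`. [cite: ConstantinIgnatovaVicol2026Putative, §3.4 eq. (3.19)] -/
def selfSimilarTransport (γ : ℝ) (c : E) (U : E → E) (y : E) : E :=
  γ • (y - c) + U y

/-- Unfolding `selfSimilarTransport` (definitional). [cite: ConstantinIgnatovaVicol2026Putative, §3.4 eq. (3.19)] -/
@[simp]
theorem selfSimilarTransport_apply (γ : ℝ) (c : E) (U : E → E) (y : E) :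
    selfSimilarTransport γ c U y = γ • (y - c) + U y := rfl

/-- The **nodal set** `𝒩_V = {y | V(y) = 0}` of the transport field `V = γ(y − c) + U` — the
stagnation points of the self-similar Lagrangian flow (Constantin–Ignatova–Vicol, Definition 3.7).
[cite: ConstantinIgnatovaVicol2026Putative, §3.5 Def. 3.7] -/
def selfSimilarNodalSet (γ : ℝ) (c : E) (U : E → E) : Set E :=
  {y | selfSimilarTransport γ c U y = 0}

/-- Membership in the nodal set: `y ∈ 𝒩_V ↔ γ(y − c) + U(y) = 0`. [cite: ConstantinIgnatovaVicol2026Putative, §3.5 Def. 3.7] -/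
@[simp]
theorem mem_selfSimilarNodalSet_iff {γ : ℝ} {c : E} {U : E → E} {y : E} :
    y ∈ selfSimilarNodalSet γ c U ↔ γ • (y - c) + U y = 0 := Iff.rfl

/-- The centre is a stagnation point iff the velocity profile vanishes there (CIV: "`0 ∈ 𝒩_V`
always", under their normalisation `U(0) = 0`, (3.5)). [cite: ConstantinIgnatovaVicol2026Putative, §3.5 Def. 3.7] -/
theorem center_mem_selfSimilarNodalSet_iff {γ : ℝ} {c : E} {U : E → E} :
    c ∈ selfSimilarNodalSet γ c U ↔ U c = 0 := by
  simp

/-- The **local outgoing property** of the transport field `V = γ(y − c) + U` with constants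
`c_* = κ ≥ 0` and `ε_* = ε > 0` (Constantin–Ignatova–Vicol, Definition 3.7): the nodal set `𝒩_V`
is finite, and for every `y_* ∈ 𝒩_V`, `V(y)·(y − y_*) ≥ c_* |y − y_*|²` whenever `|y − y_*| ≤ ε_*`
((3.37)). The degenerate value `c_* = 0` is allowed. [cite: ConstantinIgnatovaVicol2026Putative, §3.5 Def. 3.7] -/
structure IsLocallyOutgoing (γ : ℝ) (c : E) (U : E → E) (κ ε : ℝ) : Prop where
  /-- The nodal set `𝒩_V` is finite. -/
  nodalSet_finite : (selfSimilarNodalSet γ c U).Finite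
  /-- `c_* ≥ 0`. -/
  nonneg : 0 ≤ κ
  /-- `ε_* > 0`. -/
  pos : 0 < ε
  /-- `V(y)·(y − y_*) ≥ c_* |y − y_*|²` for `|y − y_*| ≤ ε_*`, at every `y_* ∈ 𝒩_V` ((3.37)). -/
  outgoing : ∀ z ∈ selfSimilarNodalSet γ c U, ∀ y, ‖y - z‖ ≤ ε →
    κ * ‖y - z‖ ^ 2 ≤ ⟪selfSimilarTransport γ c U y, y - z⟫

/-- Elgindi's **global outgoing property** (as quoted by Constantin–Ignatova–Vicol, (3.36)):
`V(y)·(y − c) = (γ(y − c) + U(y))·(y − c) ≥ c_* |y − c|²` for all `y`, for some `c_* = κ > 0`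
(centred at `c`). [cite: ConstantinIgnatovaVicol2026Putative, §3.5 eq. (3.36)] -/
structure IsGloballyOutgoing (γ : ℝ) (c : E) (U : E → E) (κ : ℝ) : Prop where
  /-- `c_* > 0`. -/
  pos : 0 < κ
  /-- `V(y)·(y − c) ≥ c_* |y − c|²` for all `y` ((3.36)). -/
  outgoing : ∀ y, κ * ‖y - c‖ ^ 2 ≤ ⟪selfSimilarTransport γ c U y, y - c⟫

/-- Under the global outgoing property the only possible stagnation point is the centre:
`𝒩_V ⊆ {c}` (CIV, second remark after Definition 3.7: "`0 = V(y_*)·y_* ≥ c_*|y_*|²` shows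
`y_* = 0` since `c_* > 0`"). [cite: ConstantinIgnatovaVicol2026Putative, §3.5 Def. 3.7 (remarks)] -/
theorem IsGloballyOutgoing.selfSimilarNodalSet_subset {γ : ℝ} {c : E} {U : E → E} {κ : ℝ}
    (h : IsGloballyOutgoing γ c U κ) : selfSimilarNodalSet γ c U ⊆ {c} := by
  intro y hy
  rw [mem_selfSimilarNodalSet_iff] at hy
  have h1 := h.outgoing y
  rw [selfSimilarTransport_apply, hy, inner_zero_left] at h1
  have h2 : ‖y - c‖ ^ 2 ≤ 0 := by
    have h3 := h.pos
    nlinarith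
  have h4 : ‖y - c‖ ^ 2 = 0 := le_antisymm h2 (sq_nonneg _)
  rw [Set.mem_singleton_iff, ← sub_eq_zero, ← norm_eq_zero]
  exact (pow_eq_zero_iff two_ne_zero).1 h4

/-- **The global outgoing property implies the local one**, for every radius `ε_* > 0` and the
same constant `c_*` (CIV, second remark after Definition 3.7). [cite: ConstantinIgnatovaVicol2026Putative, §3.5 Def. 3.7 (remarks)] -/
theorem IsGloballyOutgoing.isLocallyOutgoing {γ : ℝ} {c : E} {U : E → E} {κ : ℝ}
    (h : IsGloballyOutgoing γ c U κ) {ε : ℝ} (hε : 0 < ε) : IsLocallyOutgoing γ c U κ ε where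
  nodalSet_finite := (Set.finite_singleton c).subset h.selfSimilarNodalSet_subset
  nonneg := h.pos.le
  pos := hε
  outgoing z hz y _ := by
    obtain rfl : z = c := h.selfSimilarNodalSet_subset hz
    exact h.outgoing y

/-- **Unit stretching at the vorticity maximum — the core of CIV Proposition 3.3.** If a field
`Ω`, differentiable at `x`, satisfies a transport–stretching balance `Ω(x) + DΩ(x)[v] = w` at a
point `x` where `|Ω|` attains its global maximum, then `⟪Ω(x), w⟫ = |Ω(x)|²`: the gradient of
`|Ω|²` vanishes at the maximum, so `⟪Ω, DΩ[v]⟫ = ½ D(|Ω|²)[v] = 0`, and the identity follows by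
dotting the balance with `Ω(x)` (CIV evaluate (3.12) at `argmax |Ω|`). [cite: ConstantinIgnatovaVicol2026Putative, §3.3 Prop. 3.3] -/
theorem inner_eq_norm_sq_of_isMaxOn_norm {Ω : E → E} {x v w : E} (hΩ : DifferentiableAt ℝ Ω x)
    (hmax : IsMaxOn (fun y => ‖Ω y‖) univ x) (heq : Ω x + fderiv ℝ Ω x v = w) :
    ⟪Ω x, w⟫ = ‖Ω x‖ ^ 2 := by
  -- `|Ω|²` has a (local) maximum at `x` as well
  have hmax2 : IsLocalMax (fun y => ‖Ω y‖ ^ 2) x := by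
    refine IsMaxOn.isLocalMax (fun y _ => ?_) Filter.univ_mem
    exact pow_le_pow_left₀ (norm_nonneg _) (hmax (mem_univ y)) 2
  have hD := hΩ.hasFDerivAt.norm_sq
  have h0 := hmax2.hasFDerivAt_eq_zero hD
  have h1 : ⟪Ω x, fderiv ℝ Ω x v⟫ = 0 := by
    have h2 := congrArg (fun L : E →L[ℝ] ℝ => L v) h0
    simpa [two_nsmul] using h2
  have h3 := congrArg (fun z => ⟪Ω x, z⟫) heq
  simp only [inner_add_right, h1, add_zero] at h3
  rw [← h3, real_inner_self_eq_norm_sq]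

end Transport

/-! ### The stationary self-similar Euler equation, velocity form (3.3) -/

section Profile

variable {E : Type*} [NormedAddCommGroup E] [InnerProductSpace ℝ E] [FiniteDimensional ℝ E]

/-- **Stationary self-similar Euler profile, velocity form** (Constantin–Ignatova–Vicol, §3.1.1,
eq. (3.3)), with similarity exponent `γ` and centre `c`: `U ∈ C²`, `P ∈ C¹`, and pointwise
`(1 − γ) U + ((γ(y − c) + U)·∇) U + ∇P = 0`, `div U = 0`;
here `((γ(y−c) + U)·∇)U (y) = DU(y)[γ(y − c) + U(y)] = fderiv ℝ U y (γ • (y - c) + U y)`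
(`= γ (y−c)·∇U + (U·∇)U`, `profile_eq'`). This is the equation satisfied by the profile of the
ansatz (3.2) `u(x,t) = (1−t)^{γ−1} U((x − x_*)/(1−t)^γ + c)`, `p = (1−t)^{2(γ−1)} P(…)` for the 3D
Euler equations; CIV take `c = 0` (and, separately, the normalisations (3.5) `U(0) = 0`, (3.7),
and the decay (3.8), none of which is part of this predicate — see `HasSelfSimilarFarFieldWith`).
The exponent `γ` is not constrained here (CIV: `γ > 0`). Stated on any finite-dimensional real
inner product space. [cite: ConstantinIgnatovaVicol2026Putative, §3.1.1 eq. (3.3)] -/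
structure IsSelfSimilarEulerProfile (γ : ℝ) (c : E) (U : E → E) (P : E → ℝ) : Prop where
  /-- The velocity profile is `C²`. -/
  contDiff_velocity : ContDiff ℝ 2 U
  /-- The pressure profile is `C¹`. -/
  contDiff_pressure : ContDiff ℝ 1 P
  /-- The profile equation `(1−γ)U + ((γ(y−c) + U)·∇)U + ∇P = 0` (CIV (3.3)). -/
  profile_eq : ∀ y, (1 - γ) • U y + fderiv ℝ U y (γ • (y - c) + U y) + gradient P y = 0
  /-- Incompressibility `div U = 0` (CIV (3.3)). -/
  divFree : VectorCalculus.IsDivFree U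

/-- The **self-similar Bernoulli function** `ℋ(y) = ½|γ(y − c) + U(y)|² + P(y) + ½γ(γ−1)|y − c|²`
(Constantin–Ignatova–Vicol, (3.30), centred at `c`; after Nečas–Růžička–Šverák's Bernoulli
function for the Navier–Stokes profile). The profile equation (3.3) is equivalent to
`(1−2γ)V + Ω × V + ∇ℋ = 0` ((3.29)) and `V·∇ℋ = (2γ−1)|V|²` ((3.31),
`IsSelfSimilarEulerProfile.fderiv_selfSimilarBernoulli_transport`). [cite: ConstantinIgnatovaVicol2026Putative, §3.4.3 eq. (3.30)] -/
def selfSimilarBernoulli (γ : ℝ) (c : E) (U : E → E) (P : E → ℝ) (y : E) : ℝ :=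
  (1 / 2 : ℝ) * ‖γ • (y - c) + U y‖ ^ 2 + P y + γ * (γ - 1) / 2 * ‖y - c‖ ^ 2

omit [FiniteDimensional ℝ E] in
/-- Unfolding `selfSimilarBernoulli` (definitional). [cite: ConstantinIgnatovaVicol2026Putative, §3.4.3 eq. (3.30)] -/
@[simp]
theorem selfSimilarBernoulli_apply (γ : ℝ) (c : E) (U : E → E) (P : E → ℝ) (y : E) :
    selfSimilarBernoulli γ c U P y =
      (1 / 2 : ℝ) * ‖γ • (y - c) + U y‖ ^ 2 + P y + γ * (γ - 1) / 2 * ‖y - c‖ ^ 2 := rfl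

namespace IsSelfSimilarEulerProfile

variable {γ : ℝ} {c : E} {U : E → E} {P : E → ℝ}

/-- The profile equation in the printed split form (CIV (3.3)):
`(1−γ)U + γ ((y−c)·∇)U + (U·∇)U + ∇P = 0`, with `((y−c)·∇)U = DU(y)[y − c]` and
`(U·∇)U = convect U U`. [cite: ConstantinIgnatovaVicol2026Putative, §3.1.1 eq. (3.3)] -/
theorem profile_eq' (h : IsSelfSimilarEulerProfile γ c U P) (y : E) :
    (1 - γ) • U y + γ • fderiv ℝ U y (y - c) + convect U U y + gradient P y = 0 := by
  have e := h.profile_eq y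
  rw [map_add, map_smul] at e
  rw [convect_apply, ← e]
  abel

omit [FiniteDimensional ℝ E] in
/-- The profile equation along the transport field: `(1−γ)U + (V·∇)U + ∇P = 0`,
`V = selfSimilarTransport γ c U` (CIV (3.3) with (3.19)). [cite: ConstantinIgnatovaVicol2026Putative, §3.1.1 eq. (3.3)] -/
theorem profile_eq_transport [FiniteDimensional ℝ E] (h : IsSelfSimilarEulerProfile γ c U P) (y : E) :
    (1 - γ) • U y + fderiv ℝ U y (selfSimilarTransport γ c U y) + gradient P y = 0 :=
  h.profile_eq y

/-- The velocity profile is differentiable. [cite: ConstantinIgnatovaVicol2026Putative, §3.1.1 eq. (3.3)] -/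
theorem differentiable_velocity (h : IsSelfSimilarEulerProfile γ c U P) : Differentiable ℝ U :=
  h.contDiff_velocity.differentiable (by norm_num)

/-- The pressure profile is differentiable. [cite: ConstantinIgnatovaVicol2026Putative, §3.1.1 eq. (3.3)] -/
theorem differentiable_pressure (h : IsSelfSimilarEulerProfile γ c U P) : Differentiable ℝ P :=
  h.contDiff_pressure.differentiable one_ne_zero

/-- The trivial profile `U = 0`, `P = 0` (excluded in CIV's theorems by "nontrivial"). [folklore] -/
protected theorem zero (γ : ℝ) (c : E) : IsSelfSimilarEulerProfile γ c (0 : E → E) (0 : E → ℝ) where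
  contDiff_velocity := contDiff_const
  contDiff_pressure := contDiff_const
  profile_eq y := by simp [Pi.zero_def, gradient]
  divFree y := by simp [VectorCalculus.divergence, Pi.zero_def]

/-- **Translation.** If `(U, P)` is a profile with centre `c`, then `(U(· + a), P(· + a))` is a
profile with centre `c − a` (the PDE (3.3) is autonomous up to the drift `γ(y − c)`); with `a = c`
this recentres CIV's `c = 0` convention. [cite: ConstantinIgnatovaVicol2026Putative, §3.1 (Galilean symmetry, `x_* = 0`)] -/
theorem comp_add_right (h : IsSelfSimilarEulerProfile γ c U P) (a : E) :
    IsSelfSimilarEulerProfile γ (c - a) (fun y => U (y + a)) (fun y => P (y + a)) where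
  contDiff_velocity := h.contDiff_velocity.comp (contDiff_id.add contDiff_const)
  contDiff_pressure := h.contDiff_pressure.comp (contDiff_id.add contDiff_const)
  profile_eq y := by
    have hU : fderiv ℝ (fun y => U (y + a)) y = fderiv ℝ U (y + a) := fderiv_comp_add_right a
    have hP : gradient (fun y => P (y + a)) y = gradient P (y + a) := by
      simp only [gradient, fderiv_comp_add_right]
    rw [hU, hP, show y - (c - a) = (y + a) - c by abel]
    exact h.profile_eq (y + a)
  divFree y := by
    have e := h.divFree (y + a)
    simpa only [VectorCalculus.divergence, fderiv_comp_add_right] using e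

/-- **Change of centre (the centre is a gauge).** If `(U, P)` is a profile with centre `c`, then
for every `b`, `(U + γ b, P − (1−γ)γ ⟪b, ·⟫)` is a profile with centre `c + b` and the SAME
transport field `V`: `γ(y − c − b) + (U + γb) = γ(y − c) + U`, while the constant `(1−γ)γ b` is a
pressure gradient. (So without CIV's normalisation (3.5) `U(c) = 0` the centre carries no
information; the far-field bound (3.8) restores it, `HasSelfSimilarFarFieldWith.apply_center`.)
[cite: ConstantinIgnatovaVicol2026Putative, §3.1 (Galilean symmetry) with §3.1.1 eq. (3.3)] -/
theorem recenter (h : IsSelfSimilarEulerProfile γ c U P) (b : E) :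
    IsSelfSimilarEulerProfile γ (c + b) (fun y => U y + γ • b)
      (fun y => P y - (1 - γ) * γ * ⟪b, y⟫) where
  contDiff_velocity := h.contDiff_velocity.add contDiff_const
  contDiff_pressure :=
    h.contDiff_pressure.sub (contDiff_const.mul (contDiff_const.inner ℝ contDiff_id))
  profile_eq y := by
    have hU : fderiv ℝ (fun y => U y + γ • b) y = fderiv ℝ U y := fderiv_add_const _
    have hdP : DifferentiableAt ℝ P y := h.differentiable_pressure y
    have hL : HasFDerivAt (fun z : E => (1 - γ) * γ * ⟪b, z⟫) (((1 - γ) * γ) • toDual ℝ E b) y :=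
      (toDual ℝ E b).hasFDerivAt.const_mul ((1 - γ) * γ)
    have hP : gradient (fun y => P y - (1 - γ) * γ * ⟪b, y⟫) y =
        gradient P y - ((1 - γ) * γ) • b := by
      rw [gradient, gradient, fderiv_fun_sub hdP hL.differentiableAt, hL.fderiv, map_sub, map_smul,
        (toDual ℝ E).symm_apply_apply]
    have hV : γ • (y - (c + b)) + (U y + γ • b) = γ • (y - c) + U y := by module
    rw [hU, hP, hV]
    have key := h.profile_eq y
    calc (1 - γ) • (U y + γ • b) + fderiv ℝ U y (γ • (y - c) + U y)
          + (gradient P y - ((1 - γ) * γ) • b)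
        = ((1 - γ) • U y + fderiv ℝ U y (γ • (y - c) + U y) + gradient P y)
          + ((1 - γ) • γ • b - ((1 - γ) * γ) • b) := by module
      _ = 0 := by rw [key, mul_smul, sub_self, add_zero]
  divFree y := by
    have e := h.divFree y
    simpa only [VectorCalculus.divergence, fderiv_add_const] using e

/-- **The Bernoulli transport identity (CIV (3.31)).** For a profile `(U, P)`,
`V·∇ℋ = (2γ − 1)|V|²` pointwise, `V = γ(y−c) + U`, `ℋ` the self-similar Bernoulli function:
`Dℋ(y)[V] = ⟪V, DV[V]⟫ + DP[V] + γ(γ−1)⟪y−c, V⟫` with `DV = γ id + DU` and, by (3.3),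
`DU[V] = −(1−γ)U − ∇P`, so `Dℋ[V] = γ|V|² − (1−γ)⟪V, U + γ(y−c)⟫ = (2γ−1)|V|²`. In particular
for `γ < ½` the Bernoulli function is non-increasing along self-similar Lagrangian trajectories and
strictly decreasing off the nodal set ((3.33)). [cite: ConstantinIgnatovaVicol2026Putative, §3.4.3 eq. (3.31)] -/
theorem fderiv_selfSimilarBernoulli_transport (h : IsSelfSimilarEulerProfile γ c U P) (y : E) :
    fderiv ℝ (selfSimilarBernoulli γ c U P) y (selfSimilarTransport γ c U y) =
      (2 * γ - 1) * ‖selfSimilarTransport γ c U y‖ ^ 2 := by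
  simp only [selfSimilarTransport_apply]
  -- derivatives of the three summands of `ℋ`
  have hU : HasFDerivAt U (fderiv ℝ U y) y := (h.differentiable_velocity y).hasFDerivAt
  have hV : HasFDerivAt (fun z => γ • (z - c) + U z)
      (γ • ContinuousLinearMap.id ℝ E + fderiv ℝ U y) y :=
    (((hasFDerivAt_id y).sub_const c).fun_const_smul γ).fun_add hU
  have hP : HasFDerivAt P (fderiv ℝ P y) y := (h.differentiable_pressure y).hasFDerivAt
  have hsq := ((hasFDerivAt_id y).sub_const c).norm_sq
  have e := ((hV.norm_sq.const_mul (1 / 2 : ℝ)).fun_add hP).fun_add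
    (hsq.const_mul (γ * (γ - 1) / 2))
  have hH : HasFDerivAt (selfSimilarBernoulli γ c U P) _ y :=
    e.congr_of_eventuallyEq (Filter.Eventually.of_forall fun z => rfl)
  rw [hH.fderiv]
  -- the profile equation (3.3) dotted with `V(y)`
  have key : ⟪γ • (y - c) + U y, fderiv ℝ U y (γ • (y - c) + U y)⟫ =
      -((1 - γ) * ⟪γ • (y - c) + U y, U y⟫) - fderiv ℝ P y (γ • (y - c) + U y) := by
    have e2 := congrArg (fun z => ⟪γ • (y - c) + U y, z⟫) (h.profile_eq y)
    simp only [inner_add_right, inner_smul_right, inner_zero_right] at e2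
    rw [real_inner_comm (gradient P y), inner_gradient_left] at e2
    linarith
  -- `⟪V, U⟫ = |V|² − γ ⟪V, y − c⟫`
  have h5 : ⟪γ • (y - c) + U y, U y⟫ =
      ‖γ • (y - c) + U y‖ ^ 2 - γ * ⟪γ • (y - c) + U y, y - c⟫ := by
    rw [← real_inner_self_eq_norm_sq, ← inner_smul_right, ← inner_sub_right, add_sub_cancel_left]
  have h6 : ⟪y - c, γ • (y - c) + U y⟫ = ⟪γ • (y - c) + U y, y - c⟫ := real_inner_comm _ _
  have h7 : ⟪γ • (y - c) + U y, γ • (γ • (y - c) + U y) + fderiv ℝ U y (γ • (y - c) + U y)⟫ =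
      γ * ‖γ • (y - c) + U y‖ ^ 2 + ⟪γ • (y - c) + U y, fderiv ℝ U y (γ • (y - c) + U y)⟫ := by
    rw [inner_add_right, inner_smul_right, real_inner_self_eq_norm_sq]
  simp only [_root_.add_apply, _root_.smul_apply, two_nsmul, ContinuousLinearMap.comp_apply,
    ContinuousLinearMap.id_apply, innerSL_apply_apply, smul_eq_mul, id_eq]
  rw [h7, h6]
  linear_combination key + (γ - 1) * h5

end IsSelfSimilarEulerProfile

end Profile

/-! ### Three dimensions: far-field bounds (3.8) and the vorticity form (3.4) -/

section SpaceDimThree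

/-- Local notation for physical space `ℝ³ = EuclideanSpace ℝ (Fin 3)`. -/
local notation "ℝ³" => EuclideanSpace ℝ (Fin 3)

/-- **The far-field bounds of a self-similar Euler profile** (Constantin–Ignatova–Vicol, §3.1.3,
eq. (3.8)), centred at `c`, with constant `C♭ = C`:
`|U(y)| ≤ C |y − c| ⟨y − c⟩^{−1/γ}` and `|Ω(y)| + |∇U(y)| ≤ C ⟨y − c⟩^{−1/γ}` for all `y`, where
`Ω = curl U`, `⟨z⟩ = (1 + |z|²)^{1/2}` (so `⟨z⟩^{−1/γ} = (1 + |z|²)^{−1/(2γ)}`) and `|∇U(y)|` is the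
operator norm of `DU(y)`. These quantify the leading far-field behaviour `|U| ∼ |y|^{(γ−1)/γ}`,
`|Ω| ∼ |y|^{−1/γ}` dictated by (3.3)–(3.4), and encode CIV's normalisation `U(c) = 0` ((3.5);
`apply_center`). Meaningful for `γ > 0`. [cite: ConstantinIgnatovaVicol2026Putative, §3.1.3 eq. (3.8)] -/
def HasSelfSimilarFarFieldWith (γ : ℝ) (c : ℝ³) (C : ℝ) (U : ℝ³ → ℝ³) : Prop :=
  ∀ y, ‖U y‖ ≤ C * ‖y - c‖ * (1 + ‖y - c‖ ^ 2) ^ (-(1 / (2 * γ))) ∧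
    ‖curl U y‖ + ‖fderiv ℝ U y‖ ≤ C * (1 + ‖y - c‖ ^ 2) ^ (-(1 / (2 * γ)))

/-- The far-field bounds (3.8) with SOME constant `C♭` ("we assume that there exists a constant
`C♭ > 0` such that (3.8)"; any admissible constant may be enlarged, so positivity is not recorded).
[cite: ConstantinIgnatovaVicol2026Putative, §3.1.3 eq. (3.8)] -/
def HasSelfSimilarFarField (γ : ℝ) (c : ℝ³) (U : ℝ³ → ℝ³) : Prop :=
  ∃ C, HasSelfSimilarFarFieldWith γ c C U

namespace HasSelfSimilarFarFieldWith

variable {γ C : ℝ} {c : ℝ³} {U : ℝ³ → ℝ³}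

/-- The velocity bound of (3.8): `|U(y)| ≤ C |y − c| ⟨y − c⟩^{−1/γ}`. [cite: ConstantinIgnatovaVicol2026Putative, §3.1.3 eq. (3.8)] -/
theorem norm_le (h : HasSelfSimilarFarFieldWith γ c C U) (y : ℝ³) :
    ‖U y‖ ≤ C * ‖y - c‖ * (1 + ‖y - c‖ ^ 2) ^ (-(1 / (2 * γ))) :=
  (h y).1

/-- The gradient/vorticity bound of (3.8): `|curl U(y)| + |DU(y)| ≤ C ⟨y − c⟩^{−1/γ}`. [cite: ConstantinIgnatovaVicol2026Putative, §3.1.3 eq. (3.8)] -/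
theorem norm_curl_add_norm_fderiv_le (h : HasSelfSimilarFarFieldWith γ c C U) (y : ℝ³) :
    ‖curl U y‖ + ‖fderiv ℝ U y‖ ≤ C * (1 + ‖y - c‖ ^ 2) ^ (-(1 / (2 * γ))) :=
  (h y).2

/-- The vorticity bound `|Ω(y)| ≤ C ⟨y − c⟩^{−1/γ}` from (3.8). [cite: ConstantinIgnatovaVicol2026Putative, §3.1.3 eq. (3.8)] -/
theorem norm_curl_le (h : HasSelfSimilarFarFieldWith γ c C U) (y : ℝ³) :
    ‖curl U y‖ ≤ C * (1 + ‖y - c‖ ^ 2) ^ (-(1 / (2 * γ))) :=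
  le_trans (le_add_of_nonneg_right (norm_nonneg _)) (h.norm_curl_add_norm_fderiv_le y)

/-- The velocity-gradient bound `|DU(y)| ≤ C ⟨y − c⟩^{−1/γ}` from (3.8). [cite: ConstantinIgnatovaVicol2026Putative, §3.1.3 eq. (3.8)] -/
theorem norm_fderiv_le (h : HasSelfSimilarFarFieldWith γ c C U) (y : ℝ³) :
    ‖fderiv ℝ U y‖ ≤ C * (1 + ‖y - c‖ ^ 2) ^ (-(1 / (2 * γ))) :=
  le_trans (le_add_of_nonneg_left (norm_nonneg _)) (h.norm_curl_add_norm_fderiv_le y)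

/-- The bounds hold with some constant. [cite: ConstantinIgnatovaVicol2026Putative, §3.1.3 eq. (3.8)] -/
theorem hasSelfSimilarFarField (h : HasSelfSimilarFarFieldWith γ c C U) :
    HasSelfSimilarFarField γ c U :=
  ⟨C, h⟩

/-- An admissible constant is nonnegative (evaluate the gradient bound anywhere). [cite: ConstantinIgnatovaVicol2026Putative, §3.1.3 eq. (3.8)] -/
theorem nonneg (h : HasSelfSimilarFarFieldWith γ c C U) : 0 ≤ C := by
  have h1 := h.norm_curl_add_norm_fderiv_le c
  have hb : 0 < (1 + ‖c - c‖ ^ 2) ^ (-(1 / (2 * γ))) := Real.rpow_pos_of_pos (by positivity) _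
  have h2 : 0 ≤ C * (1 + ‖c - c‖ ^ 2) ^ (-(1 / (2 * γ))) := le_trans (by positivity) h1
  exact nonneg_of_mul_nonneg_left h2 hb

/-- **The far-field bounds pin the centre**: `U(c) = 0` (the factor `|y − c|` in (3.8); CIV's
normalisation (3.5) `U(0) = 0`). [cite: ConstantinIgnatovaVicol2026Putative, §3.1.3 eq. (3.8) with (3.5)] -/
theorem apply_center (h : HasSelfSimilarFarFieldWith γ c C U) : U c = 0 := by
  have h1 := h.norm_le c
  rw [sub_self, norm_zero, mul_zero, zero_mul] at h1
  exact norm_le_zero_iff.1 h1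

/-- Hence the centre is a stagnation point of the transport field: `c ∈ 𝒩_V` (CIV: "`0 ∈ 𝒩_V`
always"). [cite: ConstantinIgnatovaVicol2026Putative, §3.5 Def. 3.7 (remarks)] -/
theorem center_mem_selfSimilarNodalSet (h : HasSelfSimilarFarFieldWith γ c C U) :
    c ∈ selfSimilarNodalSet γ c U :=
  center_mem_selfSimilarNodalSet_iff.2 h.apply_center

/-- **Sublinear growth of the velocity**: `|U(y)| ≤ C ⟨y − c⟩^{1 − 1/γ}` (since `|y − c| ≤ ⟨y − c⟩`),
the form `|U| ≲ |y|^{(γ−1)/γ}` of the leading far-field behaviour (CIV §3.1.3); for `0 < γ < 1`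
this is the sublinearity (3.5). [cite: ConstantinIgnatovaVicol2026Putative, §3.1.3 eq. (3.8)] -/
theorem norm_le_rpow (h : HasSelfSimilarFarFieldWith γ c C U) (y : ℝ³) :
    ‖U y‖ ≤ C * (1 + ‖y - c‖ ^ 2) ^ ((1 - 1 / γ) / 2) := by
  have hC : 0 ≤ C := h.nonneg
  have hb : 0 < 1 + ‖y - c‖ ^ 2 := by positivity
  have h1 : ‖y - c‖ ≤ (1 + ‖y - c‖ ^ 2) ^ (1 / 2 : ℝ) := by
    rw [← Real.sqrt_eq_rpow]
    calc ‖y - c‖ = Real.sqrt (‖y - c‖ ^ 2) := (Real.sqrt_sq (norm_nonneg _)).symm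
      _ ≤ Real.sqrt (1 + ‖y - c‖ ^ 2) := Real.sqrt_le_sqrt (by linarith)
  calc ‖U y‖ ≤ C * ‖y - c‖ * (1 + ‖y - c‖ ^ 2) ^ (-(1 / (2 * γ))) := h.norm_le y
    _ ≤ C * (1 + ‖y - c‖ ^ 2) ^ (1 / 2 : ℝ) * (1 + ‖y - c‖ ^ 2) ^ (-(1 / (2 * γ))) := by
        gcongr
    _ = C * (1 + ‖y - c‖ ^ 2) ^ ((1 - 1 / γ) / 2) := by
        rw [mul_assoc, ← Real.rpow_add hb]
        congr 1
        ring_nf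

end HasSelfSimilarFarFieldWith

/-- `HasSelfSimilarFarField` forces `U(c) = 0`. [cite: ConstantinIgnatovaVicol2026Putative, §3.1.3 eq. (3.8) with (3.5)] -/
theorem HasSelfSimilarFarField.apply_center {γ : ℝ} {c : ℝ³} {U : ℝ³ → ℝ³}
    (h : HasSelfSimilarFarField γ c U) : U c = 0 := by
  obtain ⟨C, hC⟩ := h
  exact hC.apply_center

/-- **Stationary self-similar Euler profile, vorticity form** (Constantin–Ignatova–Vicol, §3.1.1,
eq. (3.4)), exponent `γ`, centre `c`, on `ℝ³`: `U ∈ C²`, `div U = 0`, and with `Ω := curl U`,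
`Ω + ((γ(y − c) + U)·∇) Ω = (Ω·∇) U` pointwise, i.e.
`curl U y + D(curl U)(y)[γ(y−c) + U(y)] = DU(y)[curl U y]`. CIV: "(3.3), or equivalently (3.4)"
(the curl of (3.3); the equivalence is not proved in this file). [cite: ConstantinIgnatovaVicol2026Putative, §3.1.1 eq. (3.4)] -/
structure IsSelfSimilarEulerVorticityProfile (γ : ℝ) (c : ℝ³) (U : ℝ³ → ℝ³) : Prop where
  /-- The velocity profile is `C²`. -/
  contDiff_velocity : ContDiff ℝ 2 U
  /-- The vorticity equation `Ω + ((γ(y−c) + U)·∇)Ω = (Ω·∇)U`, `Ω = curl U` (CIV (3.4)). -/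
  vorticity_eq : ∀ y,
    curl U y + fderiv ℝ (curl U) y (γ • (y - c) + U y) = fderiv ℝ U y (curl U y)
  /-- Incompressibility `div U = 0` (CIV (3.4)). -/
  divFree : VectorCalculus.IsDivFree U

/-- The curl of a `C²` field on `ℝ³` is differentiable (each component of `curl U` is a fixed
linear combination of entries of the `C¹` Jacobian `DU`). [folklore] -/
theorem differentiable_curl_of_contDiff {U : ℝ³ → ℝ³} (hU : ContDiff ℝ 2 U) :
    Differentiable ℝ (curl U) := by
  have hd : Differentiable ℝ (fderiv ℝ U) :=
    (hU.fderiv_right (m := 1) (by norm_num)).differentiable one_ne_zero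
  have hg : ∀ j i : Fin 3, Differentiable ℝ fun x => fderiv ℝ U x (EuclideanSpace.single j 1) i :=
    fun j i => differentiable_euclidean.1 (hd.clm_apply (differentiable_const _)) i
  refine differentiable_euclidean.2 fun i => ?_
  fin_cases i
  · simpa [curl] using (hg 1 2).fun_sub (hg 2 1)
  · simpa [curl] using (hg 2 0).fun_sub (hg 0 2)
  · simpa [curl] using (hg 0 1).fun_sub (hg 1 0)

namespace IsSelfSimilarEulerVorticityProfile

variable {γ : ℝ} {c : ℝ³} {U : ℝ³ → ℝ³}

/-- The vorticity equation along the transport field: `Ω + (V·∇)Ω = (Ω·∇)U`,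
`V = selfSimilarTransport γ c U` (CIV (3.4) with (3.19); in the proof of Thm. 3.8 CIV write the
right-hand side as `𝕊Ω`, `𝕊 = ½(∇U + ∇Uᵀ)`, since `(∇U − ∇Uᵀ)Ω = Ω × Ω = 0`). [cite: ConstantinIgnatovaVicol2026Putative, §3.1.1 eq. (3.4)] -/
theorem vorticity_eq_transport (h : IsSelfSimilarEulerVorticityProfile γ c U) (y : ℝ³) :
    curl U y + fderiv ℝ (curl U) y (selfSimilarTransport γ c U y) = fderiv ℝ U y (curl U y) :=
  h.vorticity_eq y

/-- The vorticity `Ω = curl U` of a vorticity-form profile is differentiable. [cite: ConstantinIgnatovaVicol2026Putative, §3.1.1 eq. (3.4)] -/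
theorem differentiable_curl (h : IsSelfSimilarEulerVorticityProfile γ c U) :
    Differentiable ℝ (curl U) :=
  differentiable_curl_of_contDiff h.contDiff_velocity

/-- **CIV Proposition 3.3 (unit stretching at the vorticity maximum).** If `|Ω|`, `Ω = curl U`,
attains its global maximum at `y_*`, then `⟪Ω(y_*), DU(y_*) Ω(y_*)⟫ = |Ω(y_*)|²`; equivalently, when
`Ω(y_*) ≠ 0`, the self-similar stretching factor `α(y_*) = ξ·∇U ξ = 1`, `ξ = Ω/|Ω|`
(`stretching_eq_one_of_isMaxOn`). Proof: `inner_eq_norm_sq_of_isMaxOn_norm` applied to (3.4) at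
`y_*`. [cite: ConstantinIgnatovaVicol2026Putative, §3.3 Prop. 3.3] -/
theorem inner_fderiv_curl_eq_norm_sq (h : IsSelfSimilarEulerVorticityProfile γ c U) {x : ℝ³}
    (hmax : IsMaxOn (fun y => ‖curl U y‖) univ x) :
    ⟪curl U x, fderiv ℝ U x (curl U x)⟫ = ‖curl U x‖ ^ 2 :=
  inner_eq_norm_sq_of_isMaxOn_norm (h.differentiable_curl x) hmax (h.vorticity_eq x)

/-- **CIV Proposition 3.3, normalised form**: at a global maximum `y_*` of `|Ω|` with
`Ω(y_*) ≠ 0` (i.e. `Ω ≢ 0`), the stretching factor of the vorticity direction `ξ = Ω/|Ω|` is one: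
`⟪ξ, DU(y_*) ξ⟫ = 1`. [cite: ConstantinIgnatovaVicol2026Putative, §3.3 Prop. 3.3] -/
theorem stretching_eq_one_of_isMaxOn (h : IsSelfSimilarEulerVorticityProfile γ c U) {x : ℝ³}
    (hmax : IsMaxOn (fun y => ‖curl U y‖) univ x) (hx : curl U x ≠ 0) :
    ⟪‖curl U x‖⁻¹ • curl U x, fderiv ℝ U x (‖curl U x‖⁻¹ • curl U x)⟫ = 1 := by
  have hn : ‖curl U x‖ ≠ 0 := norm_ne_zero_iff.2 hx
  rw [map_smul, inner_smul_left, inner_smul_right, h.inner_fderiv_curl_eq_norm_sq hmax]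
  simp only [conj_trivial]
  field_simp

end IsSelfSimilarEulerVorticityProfile

end SpaceDimThree

end Literature.Analysis.FluidPDE
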